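import Summits.QuantumFields.YangMills.Theorems.BalabanUVNodesN15KingModelLandauFlux
import HarnessLib

/-!
# BalabanUVNodes ∕ N15 — THE KING-MODEL RUNG (PART Ϡ-k): THE MAGNETIC LENGTH — the covariance of King's covariant fine operator at the constant-flux field decays exponentially at the EXPLICIT rate
# `δ = √(|p′|∕(16(d+1)))` per lattice step with prefactor `8∕(c|p′|)` (massless) — i.e. over `≍ |p′|^{−1∕2}` lattice steps, the MAGNETIC LENGTH (the same scale as PART Ϡ-g's optimal tent
# width `ℓ ≍ θ^{−1∕2}`); in King's units (`c = η⁻²`, `θ = Bη²`) the rate per unit PHYSICAL length is `√|B|∕(4√(d+1))` and the prefactor `8∕|B|` — BOTH η-UNIFORM: the massless charged covariance at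
# fixed curvature decays on the physical magnetic length `|B|^{−1∕2}`, uniformly in the lattice spacing
# (Track A, DAG node N15 = NE2 «η-rates ∕ η-uniformity of the covariance pieces»; FAN-OUT v1.1 §N15 s3 «KING-MODEL RUNG … + what the curved case adds»; count-neutral)

HONEST FRAMING.  Count-neutral (cell `pub-ymgap`, seat `pub-ymgap-dag-n15-e` g47; `--supports stmt-QuantumFields-27247 --as helper` = K3ᴬ, KEY MAP v3).  PART Ϳ-g's covariant Combes–Thomas engine
(`norm_covLapF_inv_entry_le_exp_of_coercive`) fed with PART Ϡ-c's Landau floor `c|p′|∕4` at an explicit admissible rate; King's fine covariance layer ([King1986] (4.4) p.670, decay template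
(4.38) p.674; [Balaban1985BackgroundPropagators] (3.23) p.394, (3.39)∕(3.42) p.397 shape only) at the `U(1)` constant-flux field (Landau gauge).  NOT Bałaban's `G_k(U)`; NOT [B9] (3.42) itself;
NOT a node discharge (N15 of record untouched); nothing continuum-YM ∕ ℝ⁴ ∕ OS ∕ Clay.

THE RESULTS (`U = fluxLink p ν₁`, `p_{ν₁} = 0`, `ν₀ ≠ ν₁`, `0 < |p′_{ν₀}| ≤ 1`, `c > 0`; `d(x,y) = tdistT`):
* `magneticRate_sq` ∕ `magneticRate_admissible` (`δ := √(|p′|∕(16(d+1)))`: `0 ≤ δ ≤ 1`, `2(d+1)c(cosh δ − 1) ≤ c|p′|∕8`);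
* ★★★ **`norm_covLapF_fluxLink_inv_entry_le_magnetic`** (any `m² ≥ 0`): `‖(−cΔ_U+m²)⁻¹(x,y)‖ ≤ (m² + c|p′|∕8)⁻¹·exp(−√(|p′|∕(16(d+1)))·d(x,y))`;
* ★★★ **`norm_covLapF_fluxLink_massless_inv_entry_le_magnetic`**: `‖(−cΔ_U)⁻¹(x,y)‖ ≤ (8∕(c|p′|))·exp(−√(|p′|∕(16(d+1)))·d(x,y))` — decay over the MAGNETIC LENGTH `≍ |p′|^{−1∕2}` lattice steps;
* ★★★ **`norm_covLapF_fluxLink_massless_inv_entry_le_physical`** (King's units, `B := c·p′`, `c > 0`): `‖(−cΔ_U)⁻¹(x,y)‖ ≤ (8∕|B|)·exp(−(√|B|∕(4√(d+1)))·(c^{−1∕2}·d(x,y)))` — with `c = η⁻²`,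
  `c^{−1∕2}d(x,y) = η·d(x,y)` is the PHYSICAL distance: prefactor and rate are η-UNIFORM (contrast: at `U ≡ 1` the massless covariance does not exist; at a toron its bound degrades with the
  volume, PART Ͷ-d).
PRIOR TREE ART (by name): Ϳ-g (`norm_covLapF_inv_entry_le_exp_of_coercive`), Ϡ-a (`landauGap_ge_quarter`, `landauGap_zero`), Ϡ-c (`re_quadForm_covLapF_fluxLink_ge_landau`, `landauGap_sOf_pos`), Ͻ-q
(`fluxLink`, `fluxLink_mem_unitaryGroup`), `King1986.Torus.tdistT`, `QuantumLattice.cosh_sub_one_le_sq_of_abs_le_one`, Mathlib (`Real.sqrt_le_one`, `Real.sq_sqrt`, `Real.sqrt_inv`).  Dedup (rg at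
filing): basename 0 files; needles `magneticRate|_le_magnetic|_inv_entry_le_physical` 0 tree files.  Locators: [King1986] (4.4) p.670, (4.38) p.674; [Balaban1985BackgroundPropagators] (3.23) p.394,
(3.39) p.397; [LandauLifshitzQM] §112 (magnetic length, notion).  0 `sorry`, 0 `def`.
-/

noncomputable section
open scoped BigOperators ComplexConjugate ComplexOrder
open Finset Matrix WithLp

namespace Summit.QuantumFields.YangMills.BalabanUVNodes.N15KingModelRung.Landau

open Literature.MathematicalPhysics.QuantumFieldTheory.Balaban1983to89.B5Prop11Plancherel (Tor unitVec sOf)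
open Literature.MathematicalPhysics.QuantumFieldTheory.King1986.Torus (tdistT tdistT_nonneg)
open Literature.MathematicalPhysics.QuantumLattice (cosh_sub_one_le_sq_of_abs_le_one)
open Summit.QuantumFields.YangMills.BalabanUVNodes.N15KingModelRung.Covariant (covLapF fib)
open Summit.QuantumFields.YangMills.BalabanUVNodes.N15KingModelRung.Cover (fluxLink fluxLink_mem_unitaryGroup)
open Summit.QuantumFields.YangMills.BalabanUVNodes.N15KingModelRung.Curvature (norm_covLapF_inv_entry_le_exp_of_coercive)

variable {d : ℕ} (K : Fin (d + 1) → ℕ) [hK : ∀ μ, NeZero (K μ)] {c : ℝ}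

omit hK in
/-- THE MAGNETIC RATE `δ = √(t∕(16(d+1)))` for a flux size `0 ≤ t ≤ 1`: `0 ≤ δ ≤ 1` and `δ² = t∕(16(d+1))`. [folklore] -/
theorem magneticRate_sq {t : ℝ} (ht0 : 0 ≤ t) (ht1 : t ≤ 1) :
    0 ≤ Real.sqrt (t / (16 * ((d : ℝ) + 1))) ∧ Real.sqrt (t / (16 * ((d : ℝ) + 1))) ≤ 1 ∧ (Real.sqrt (t / (16 * ((d : ℝ) + 1)))) ^ 2 = t / (16 * ((d : ℝ) + 1)) := by
  have hd : (0 : ℝ) < 16 * ((d : ℝ) + 1) := by positivity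
  refine ⟨Real.sqrt_nonneg _, ?_, Real.sq_sqrt (by positivity)⟩
  rw [Real.sqrt_le_one]
  rw [div_le_one hd]; nlinarith

omit hK in
/-- ★ THE MAGNETIC RATE IS ADMISSIBLE for Ϳ-g's Combes–Thomas engine at the Landau floor: `2(d+1)c(cosh δ − 1) ≤ c·t∕8` (`c ≥ 0`, `0 ≤ t ≤ 1`, `δ = √(t∕(16(d+1)))`). [folklore] -/
theorem magneticRate_admissible (hc : 0 ≤ c) {t : ℝ} (ht0 : 0 ≤ t) (ht1 : t ≤ 1) :
    2 * ((d : ℝ) + 1) * c * (Real.cosh (Real.sqrt (t / (16 * ((d : ℝ) + 1)))) - 1) ≤ c * t / 8 := by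
  obtain ⟨h0, h1, hsq⟩ := magneticRate_sq (d := d) ht0 ht1
  have hcosh := cosh_sub_one_le_sq_of_abs_le_one (s := Real.sqrt (t / (16 * ((d : ℝ) + 1)))) (by rw [abs_of_nonneg h0]; exact h1)
  rw [hsq] at hcosh
  have hd : (0 : ℝ) < (d : ℝ) + 1 := by positivity
  calc 2 * ((d : ℝ) + 1) * c * (Real.cosh (Real.sqrt (t / (16 * ((d : ℝ) + 1)))) - 1) ≤ 2 * ((d : ℝ) + 1) * c * (t / (16 * ((d : ℝ) + 1))) :=
        mul_le_mul_of_nonneg_left hcosh (by positivity)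
    _ = c * t / 8 := by field_simp; ring

/-- ★★★ **EXPONENTIAL DECAY OVER THE MAGNETIC LENGTH** (massive or massless, `m² ≥ 0`, `c > 0`, `0 < |p′_{ν₀}| ≤ 1`, `p_{ν₁} = 0`, `ν₀ ≠ ν₁`):
`‖(−cΔ_U+m²)⁻¹(x,y)‖ ≤ (m² + c|p′|∕8)⁻¹·exp(−√(|p′|∕(16(d+1)))·d(x,y))`. [cite: King1986, (4.4) p.670, (4.38) p.674; Balaban1985BackgroundPropagators, (3.39) p.397] -/
theorem norm_covLapF_fluxLink_inv_entry_le_magnetic (hc : 0 < c) {m2 : ℝ} (hm : 0 ≤ m2) {p : Tor K} {ν₀ ν₁ : Fin (d + 1)} (hν : ν₀ ≠ ν₁) (hp : p ν₁ = 0) (hp0 : p ν₀ ≠ 0)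
    (hsmall : |sOf K p ν₀| ≤ 1) (x y : Tor K) :
    ‖(covLapF K c m2 (fluxLink K p ν₁))⁻¹ (x, ()) (y, ())‖
      ≤ (m2 + c * |sOf K p ν₀| / 8)⁻¹ * Real.exp (-(Real.sqrt (|sOf K p ν₀| / (16 * ((d : ℝ) + 1))) * tdistT K x y)) := by
  set t := |sOf K p ν₀| with ht
  have ht0 : 0 < t := abs_pos.mpr (by
    have h := landauGap_sOf_pos K hp0 hsmall
    intro h0; rw [h0, landauGap_zero] at h; exact lt_irrefl _ h)
  have hκ : 0 < m2 + c * (t / 4) := by positivity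
  have hcoer : ∀ v : Tor K × Unit → ℂ, (m2 + c * (t / 4)) * ∑ z, ‖fib K v z‖ ^ 2 ≤ RCLike.re (star v ⬝ᵥ (covLapF K c m2 (fluxLink K p ν₁) *ᵥ v)) := fun v =>
    le_trans (mul_le_mul_of_nonneg_right (by nlinarith [landauGap_ge_quarter hsmall, hc]) (Finset.sum_nonneg fun _ _ => sq_nonneg _))
      (re_quadForm_covLapF_fluxLink_ge_landau K hc.le m2 hν hp v)
  obtain ⟨hδ0, -, -⟩ := magneticRate_sq (d := d) ht0.le hsmall
  have hadm := magneticRate_admissible (d := d) hc.le ht0.le hsmall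
  have hρ : 2 * ((d : ℝ) + 1) * c * (Real.cosh (Real.sqrt (t / (16 * ((d : ℝ) + 1)))) - 1) < m2 + c * (t / 4) := by nlinarith
  have h := norm_covLapF_inv_entry_le_exp_of_coercive K hc.le m2 (fluxLink_mem_unitaryGroup K p ν₁) hκ hcoer hδ0 hρ x y () ()
  have hden : m2 + c * t / 8 ≤ m2 + c * (t / 4) - 2 * ((d : ℝ) + 1) * c * (Real.cosh (Real.sqrt (t / (16 * ((d : ℝ) + 1)))) - 1) := by linarith
  have hden0 : 0 < m2 + c * t / 8 := by positivity
  calc ‖(covLapF K c m2 (fluxLink K p ν₁))⁻¹ (x, ()) (y, ())‖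
      ≤ Real.exp (-(Real.sqrt (t / (16 * ((d : ℝ) + 1))) * tdistT K x y)) / (m2 + c * (t / 4) - 2 * ((d : ℝ) + 1) * c * (Real.cosh (Real.sqrt (t / (16 * ((d : ℝ) + 1)))) - 1)) := h
    _ ≤ Real.exp (-(Real.sqrt (t / (16 * ((d : ℝ) + 1))) * tdistT K x y)) / (m2 + c * t / 8) := div_le_div_of_nonneg_left (Real.exp_nonneg _) hden0 hden
    _ = (m2 + c * t / 8)⁻¹ * Real.exp (-(Real.sqrt (t / (16 * ((d : ℝ) + 1))) * tdistT K x y)) := by rw [div_eq_inv_mul]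

/-- ★★★ **THE MASSLESS CHARGED COVARIANCE DECAYS OVER THE MAGNETIC LENGTH**: `‖(−cΔ_U)⁻¹(x,y)‖ ≤ (8∕(c|p′|))·exp(−√(|p′|∕(16(d+1)))·d(x,y))` — `≍ |p′|^{−1∕2}` lattice steps, the scale of PART
Ϡ-g's optimal tent. [cite: King1986, (4.38) p.674; Balaban1985BackgroundPropagators, (3.39) p.397] -/
theorem norm_covLapF_fluxLink_massless_inv_entry_le_magnetic (hc : 0 < c) {p : Tor K} {ν₀ ν₁ : Fin (d + 1)} (hν : ν₀ ≠ ν₁) (hp : p ν₁ = 0) (hp0 : p ν₀ ≠ 0) (hsmall : |sOf K p ν₀| ≤ 1)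
    (x y : Tor K) :
    ‖(covLapF K c 0 (fluxLink K p ν₁))⁻¹ (x, ()) (y, ())‖ ≤ 8 / (c * |sOf K p ν₀|) * Real.exp (-(Real.sqrt (|sOf K p ν₀| / (16 * ((d : ℝ) + 1))) * tdistT K x y)) := by
  have h := norm_covLapF_fluxLink_inv_entry_le_magnetic K hc le_rfl hν hp hp0 hsmall x y
  have heq : ((0 : ℝ) + c * |sOf K p ν₀| / 8)⁻¹ = 8 / (c * |sOf K p ν₀|) := by rw [zero_add, inv_eq_one_div, div_div_eq_mul_div, one_mul]
  rwa [heq] at h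

omit hK in
/-- `c^{−1∕2}·√(c·t) = √t` for `c > 0`, `t ≥ 0` (units bookkeeping: `√|B|·η = √|p′|` with `B = c·p′`, `c = η⁻²`). [folklore] -/
theorem sqrt_mul_rescale (hc : 0 < c) {t : ℝ} (ht : 0 ≤ t) : Real.sqrt (c * t) * (Real.sqrt c)⁻¹ = Real.sqrt t := by
  rw [Real.sqrt_mul' c ht, mul_comm (Real.sqrt c), mul_assoc, mul_inv_cancel₀ (Real.sqrt_ne_zero'.mpr hc), mul_one]

/-- ★★★ **IN PHYSICAL UNITS** (`B := c·p′_{ν₀}` the curvature per unit physical area, `c = η⁻²`): `‖(−cΔ_U)⁻¹(x,y)‖ ≤ (8∕|B|)·exp(−(√|B|∕(4√(d+1)))·((√c)⁻¹·d(x,y)))` — `(√c)⁻¹d(x,y) = η·d(x,y)` is the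
physical distance; the prefactor `8∕|B|` and the rate `√|B|∕(4√(d+1))` do not see the spacing: η-UNIFORM EXPONENTIAL DECAY ON THE MAGNETIC LENGTH `|B|^{−1∕2}`.
[cite: King1986, (4.4) p.670, (4.38) p.674; Balaban1985BackgroundPropagators, (3.39) p.397] -/
theorem norm_covLapF_fluxLink_massless_inv_entry_le_physical (hc : 0 < c) {p : Tor K} {ν₀ ν₁ : Fin (d + 1)} (hν : ν₀ ≠ ν₁) (hp : p ν₁ = 0) (hp0 : p ν₀ ≠ 0) (hsmall : |sOf K p ν₀| ≤ 1)
    (x y : Tor K) :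
    ‖(covLapF K c 0 (fluxLink K p ν₁))⁻¹ (x, ()) (y, ())‖
      ≤ 8 / |c * sOf K p ν₀| * Real.exp (-(Real.sqrt |c * sOf K p ν₀| / (4 * Real.sqrt ((d : ℝ) + 1)) * ((Real.sqrt c)⁻¹ * tdistT K x y))) := by
  have h := norm_covLapF_fluxLink_massless_inv_entry_le_magnetic K hc hν hp hp0 hsmall x y
  have habs : |c * sOf K p ν₀| = c * |sOf K p ν₀| := by rw [abs_mul, abs_of_pos hc]
  have hrate : Real.sqrt |c * sOf K p ν₀| / (4 * Real.sqrt ((d : ℝ) + 1)) * ((Real.sqrt c)⁻¹ * tdistT K x y)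
      = Real.sqrt (|sOf K p ν₀| / (16 * ((d : ℝ) + 1))) * tdistT K x y := by
    rw [habs, Real.sqrt_div' _ (by positivity : (0 : ℝ) ≤ 16 * ((d : ℝ) + 1)), Real.sqrt_mul' 16 (by positivity : (0 : ℝ) ≤ (d : ℝ) + 1),
      show Real.sqrt 16 = 4 by rw [show (16 : ℝ) = 4 ^ 2 by norm_num, Real.sqrt_sq (by norm_num)], ← sqrt_mul_rescale hc (abs_nonneg (sOf K p ν₀))]
    ring
  rw [hrate, habs]
  exact h

end Summit.QuantumFields.YangMills.BalabanUVNodes.N15KingModelRung.Landau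

end
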